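import Literature.Barriers.Parity.HensleyRichards
import Literature.NumberTheory.LFunctions.MidpointSieveGain
import Literature.NumberTheory.Sieve.ErdosRankinCovering
import Mathlib.Data.Nat.ChineseRemainder
import HarnessLib

/-!
# Hensley–Richards' theorem `ρ*(x) - π(x) > (log 2 - ε) x/(log x)²` (proof)

Topic `Literature/Barriers/Parity`. Everything in this file is PROVED. It discharges the named fact
`Literature.Barriers.Parity.HensleyRichards1974` of `HensleyRichards.lean` (Richards, Bull. AMS 80
(1974), Theorem 4.1; complete proof Hensley–Richards, Acta Arith. 25 (1974), §2):
`HensleyRichards1974_holds`.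

## Proof (Richards §4.2–4.5, assembled from the tree)

Fix `ε > 0`, a large integer constant `N` and a large integer `x`; put `m = ⌊(x - 1)/2⌋`,
`z = ⌊x/(N log x)⌋` and let `R = {±q : q prime, z < q ≤ m}` ("the residual set": what is left of
`[-x/2, x/2]` after removing all multiples of all primes `p ≤ x/(N log x)`, up to the points `±1`).
* (i) `#R = 2π(m) - 2π(z) ≥ 2π(x/2) - 2 - 2π(z)`, and `2π(x/2) - π(x) ≥ (log 2 - ε/3) x/(log x)²`
  for large `x` — Richards' GAIN, §2.5 (*), which needs the prime number theorem with de la Vallée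
  Poussin's error term: the tree's PROVED `Literature.NumberTheory.LFunctions.eventually_richards_gain_nat`
  — while the LOSS `2π(z) + 2` is `≤ (8 log 4/N) x/(log x)² + 2√x + 2 < (2ε/3) x/(log x)²` by
  Chebyshev's bound (Mathlib's `Chebyshev.pi_le_log4_mul_div`) once `N > 36/ε`.
* (ii) `R` is admissible (`isAdmissibleTuple_of_noSmallPrimeFactor`): for `p ≤ z` the class
  `0 (mod p)` misses `R`; for `p > z` Richards' (**) — some class mod `p` meets `[-m, m]` only in
  numbers having a prime factor `≤ y ≤ z` — is obtained (`exists_residue_forall_dvd_of_cover`) by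
  the Chinese remainder theorem from the Westzynthius–Erdős–Rankin covering (*) of `{1, …, 4N·y}`
  by one residue class per prime `q ≤ y` (the tree's PROVED
  `Literature.NumberTheory.Sieve.exists_residueClasses_cover`), with `y = ⌊log z/log 4⌋` so that
  `y# ≤ 4^y ≤ z < p` (Mathlib's `primorial_le_four_pow`) and a class mod `p` has at most
  `2m/p + 1 < N log x + 1 ≤ 4N y` members in `[-m, m]`.
* `R ⊆ (-m - 1, -m - 1 + x]`, an interval of `x` consecutive integers, so `ρ*(x) ≥ #R`
  (`le_rhoStar_of_subset_Ioc`), and `ρ*(x) - π(x) ≥ 2π(x/2) - π(x) - 2π(z) - 2 > (log 2 - ε) x/(log x)²`.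

## References

* I. Richards, *On the incompatibility of two conjectures concerning primes*, Bull. AMS 80 (1974)
  419–438: Theorem 4.1 (p. 430), §4.2 (i)–(ii), §4.3, §4.4 (*), §4.5 (**), §2.4–2.5. [Richards1974]
* D. Hensley, I. Richards, *Primes in intervals*, Acta Arith. 25 (1974) 375–391, §2 (the complete
  proof). [HensleyRichards1974]
-/

open Filter Finset Nat
open scoped Nat.Prime

namespace Literature.Barriers.Parity

/-! ### Richards' (**): a residue class made of multiples of small primes -/

/-- **The Chinese-remainder transform of the Westzynthius–Erdős–Rankin covering (Richards' (**)).**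
If every integer of `{1, …, K}` lies in a chosen class `c q (mod q)` for some prime `q ≤ y`, and `p`
is a modulus with `y# ≤ p` such that every residue class mod `p` meets `[-m, m]` in at most `K`
points (`2m/p + 1 ≤ K`), then some residue class `r (mod p)` meets `[-m, m]` only in integers
divisible by a prime `q ≤ y` ("there exists a CONGRUENCE CLASS (mod `p`), each of whose elements
(in the interval `[-x/2, x/2]`) is divisible by some "small" prime"). The class is the one whose
least member `h₀ ∈ [-m, -m + y#)` satisfies `h₀ ≡ (1 - c q) p (mod q)` for all primes `q ≤ y`
(Chinese remainder theorem), so that its `(k+1)`-st member `h₀ + k p ≡ (k + 1 - c q) p ≡ 0 (mod q)`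
whenever `k + 1 ≡ c q (mod q)`. [cite: Richards1974, §4.5 (**)] -/
theorem exists_residue_forall_dvd_of_cover {y K p m : ℕ} {c : ℕ → ℕ}
    (hcover : ∀ i ∈ Finset.Icc 1 K, ∃ q : ℕ, q.Prime ∧ q ≤ y ∧ i ≡ c q [MOD q])
    (hp : 0 < p) (hPp : primorial y ≤ p) (hK : 2 * m / p + 1 ≤ K) :
    ∃ r : ℤ, ∀ h : ℤ, -(m : ℤ) ≤ h → h ≤ m → (p : ℤ) ∣ h - r →
      ∃ q : ℕ, q.Prime ∧ q ≤ y ∧ (q : ℤ) ∣ h := by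
  classical
  -- Chinese remainder: `k₀ ≡ (q + 1 - c q % q) * p (mod q)` for all primes `q ≤ y`
  set a : ℕ → ℕ := fun q => (q + 1 - c q % q) * p with ha
  have hs : ∀ q ∈ Nat.primesLE y, (fun q : ℕ => q) q ≠ 0 := fun q hq =>
    (Nat.prime_of_mem_primesLE hq).ne_zero
  have hpp : Set.Pairwise (↑(Nat.primesLE y) : Set ℕ) (Function.onFun Nat.Coprime fun q : ℕ => q) :=
    fun q hq q' hq' hne =>
      (Nat.coprime_primes (Nat.prime_of_mem_primesLE hq) (Nat.prime_of_mem_primesLE hq')).2 hne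
  obtain ⟨k₀, hk₀⟩ := Nat.chineseRemainderOfFinset a (fun q : ℕ => q) (Nat.primesLE y) hs hpp
  set P : ℕ := primorial y with hPdef
  have hP0 : (0 : ℤ) < P := by exact_mod_cast primorial_pos y
  -- the least member `h₀ ∈ [-m, -m + P)` of the class, `h₀ ≡ k₀ (mod P)`
  set h₀ : ℤ := -(m : ℤ) + ((k₀ : ℤ) + m) % P with hh₀
  have hh₀lo : -(m : ℤ) ≤ h₀ := by
    have := Int.emod_nonneg ((k₀ : ℤ) + m) hP0.ne'
    omega
  have hh₀hi : h₀ < -(m : ℤ) + P := by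
    have := Int.emod_lt_of_pos ((k₀ : ℤ) + m) hP0
    omega
  have hh₀P : h₀ ≡ k₀ [ZMOD P] := by
    have h1 : ((k₀ : ℤ) + m) % P ≡ (k₀ : ℤ) + m [ZMOD P] := Int.mod_modEq _ _
    have h2 := h1.add_left (-(m : ℤ))
    rw [← hh₀] at h2
    refine h2.trans ?_
    have : -(m : ℤ) + ((k₀ : ℤ) + m) = k₀ := by ring
    rw [this]
  refine ⟨h₀, fun h hlo hhi hdvd => ?_⟩
  obtain ⟨k, hk⟩ := hdvd
  -- `h = h₀ + p k` with `0 ≤ k ≤ 2m/p`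
  have hPp' : (P : ℤ) ≤ p := by exact_mod_cast hPp
  have hk0 : 0 ≤ k := by
    by_contra hneg
    push Not at hneg
    have : (p : ℤ) * k ≤ (p : ℤ) * (-1) := mul_le_mul_of_nonneg_left (by omega) (by positivity)
    omega
  have hkle : (p : ℤ) * k ≤ 2 * m := by omega
  obtain ⟨n, rfl⟩ := Int.eq_ofNat_of_zero_le hk0
  have hn : p * n ≤ 2 * m := by exact_mod_cast hkle
  have hnK : n + 1 ≤ K := by
    have : n ≤ 2 * m / p := (Nat.le_div_iff_mul_le hp).2 (by rw [mul_comm]; exact hn)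
    omega
  obtain ⟨q, hq, hqy, hmod⟩ := hcover (n + 1) (Finset.mem_Icc.2 ⟨by omega, hnK⟩)
  refine ⟨q, hq, hqy, ?_⟩
  have hqT : q ∈ Nat.primesLE y := Nat.mem_primesLE.2 ⟨hqy, hq⟩
  -- `h₀ ≡ (q + 1 - c q % q) * p (mod q)`
  have hqP : (q : ℤ) ∣ P := by
    rw [hPdef, primorial_eq_prod_primesLE]
    exact_mod_cast Finset.dvd_prod_of_mem (fun q : ℕ => q) hqT
  have h1 : h₀ ≡ ((a q : ℕ) : ℤ) [ZMOD q] :=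
    (hh₀P.of_dvd hqP).trans (Int.natCast_modEq_iff.2 (hk₀ q hqT))
  have hcq : c q % q < q := Nat.mod_lt _ hq.pos
  have ha' : ((a q : ℕ) : ℤ) = ((q : ℤ) + 1 - ((c q % q : ℕ) : ℤ)) * p := by
    simp only [ha]
    push_cast [Nat.cast_sub (show c q % q ≤ q + 1 by omega)]
    ring
  -- `k + 1 ≡ c q ≡ c q % q (mod q)`
  have h2 : ((n : ℤ) + 1) ≡ ((c q % q : ℕ) : ℤ) [ZMOD q] := by
    have h3 : ((n + 1 : ℕ) : ℤ) ≡ (c q : ℤ) [ZMOD q] := Int.natCast_modEq_iff.2 hmod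
    push_cast at h3
    refine h3.trans ?_
    rw [Int.natCast_mod]
    exact (Int.mod_modEq _ _).symm
  -- hence `h = h₀ + p n ≡ p (q + 1 - c q % q + n) ≡ p (q + (n + 1 - (c q % q))) ≡ 0 (mod q)`
  have h4 : h = h₀ + p * n := by omega
  have h5 : h ≡ (p : ℤ) * ((q : ℤ) + (((n : ℤ) + 1) - ((c q % q : ℕ) : ℤ))) [ZMOD q] := by
    rw [h4]
    have := h1.add_right ((p : ℤ) * n)
    refine this.trans ?_
    rw [ha']
    ring_nf
    rfl
  have h6 : (p : ℤ) * ((q : ℤ) + (((n : ℤ) + 1) - ((c q % q : ℕ) : ℤ))) ≡ (p : ℤ) * ((q : ℤ) + 0) [ZMOD q] :=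
    (((Int.ModEq.refl (q : ℤ)).add (Int.ModEq.sub_right _ h2 |>.trans (by simp))).mul_left _)
  have h7 : (p : ℤ) * ((q : ℤ) + 0) ≡ 0 [ZMOD q] := by
    rw [add_zero, Int.modEq_zero_iff_dvd]
    exact Dvd.intro_left _ rfl
  exact Int.modEq_zero_iff_dvd.1 ((h5.trans h6).trans h7)

/-! ### Richards' §4.2 (ii): admissibility of a set without small prime factors -/

/-- **Admissibility of the residual set (Richards §4.2 (ii), §4.3–4.5).** Let `R ⊆ [-m, m]` consist
of integers all of whose prime factors exceed `z` ("eliminate all multiples (positive and negative)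
of all primes `p ≤` [`z`]. What remains … will be called the residual set"). Suppose the integers
`{1, …, K}` are covered by one residue class per prime `q ≤ y` (Westzynthius–Erdős–Rankin (*)),
where `y ≤ z`, `y# ≤ z + 1` and `2m/(z + 1) + 1 ≤ K`. Then `R` is admissible: "For the primes
`p ≤` [`z`], this is assured in our case, since we have sieved out the congruence classes
`0 (mod p)`"; for `p > z` the class of (**) (`exists_residue_forall_dvd_of_cover`) "contains only
multiples of the small primes" `q ≤ y ≤ z`, hence no point of `R`. [cite: Richards1974, §4.2 (ii) and §4.5] -/
theorem isAdmissibleTuple_of_noSmallPrimeFactor {R : Finset ℤ} {z m y K : ℕ} {c : ℕ → ℕ}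
    (hR : ∀ h ∈ R, -(m : ℤ) ≤ h ∧ h ≤ m ∧ ∀ q : ℕ, q.Prime → (q : ℤ) ∣ h → z < q)
    (hcover : ∀ i ∈ Finset.Icc 1 K, ∃ q : ℕ, q.Prime ∧ q ≤ y ∧ i ≡ c q [MOD q])
    (hyz : y ≤ z) (hP : primorial y ≤ z + 1) (hK : 2 * m / (z + 1) + 1 ≤ K) :
    Literature.NumberTheory.Sieve.IsAdmissibleTuple R := by
  intro p hp
  by_cases hpz : p ≤ z
  · -- the class `0 (mod p)` is empty
    refine Literature.NumberTheory.Sieve.tupleResidueCount_lt_of_forall_not_dvd hp.pos (r := 0)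
      fun h hh hdvd => ?_
    rw [sub_zero] at hdvd
    exact absurd ((hR h hh).2.2 p hp hdvd) (not_lt.2 hpz)
  · -- the class of (**) is empty
    push Not at hpz
    have hK' : 2 * m / p + 1 ≤ K := by
      have : 2 * m / p ≤ 2 * m / (z + 1) := Nat.div_le_div_left (by omega) (by omega)
      omega
    obtain ⟨r, hr⟩ := exists_residue_forall_dvd_of_cover hcover hp.pos (hP.trans (by omega)) hK'
    refine Literature.NumberTheory.Sieve.tupleResidueCount_lt_of_forall_not_dvd hp.pos (r := r)
      fun h hh hdvd => ?_
    obtain ⟨hlo, hhi, hfac⟩ := hR h hh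
    obtain ⟨q, hq, hqy, hqh⟩ := hr h hlo hhi hdvd
    have := hfac q hq hqh
    omega

/-! ### The residual set `{±q : q prime, z < q ≤ m}` of the midpoint sieve -/

/-- Membership in the residual set of the midpoint sieve, `{±q : q prime, z < q ≤ m}` ("What
remains are the primes `p` between `U` and `x/2`, each occurring twice as `±p`").
[cite: Richards1974, §2.4 (Figure 3)] -/
theorem mem_residualSet_iff {z m : ℕ} {h : ℤ} :
    h ∈ ((Finset.Ioc z m).filter Nat.Prime).image (fun q : ℕ => (q : ℤ)) ∪
        ((Finset.Ioc z m).filter Nat.Prime).image (fun q : ℕ => -(q : ℤ)) ↔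
      ∃ q : ℕ, q.Prime ∧ z < q ∧ q ≤ m ∧ (h = q ∨ h = -q) := by
  simp only [Finset.mem_union, Finset.mem_image, Finset.mem_filter, Finset.mem_Ioc]
  constructor
  · rintro (⟨q, ⟨⟨hzq, hqm⟩, hq⟩, rfl⟩ | ⟨q, ⟨⟨hzq, hqm⟩, hq⟩, rfl⟩)
    · exact ⟨q, hq, hzq, hqm, Or.inl rfl⟩
    · exact ⟨q, hq, hzq, hqm, Or.inr rfl⟩
  · rintro ⟨q, hq, hzq, hqm, rfl | rfl⟩
    · exact Or.inl ⟨q, ⟨⟨hzq, hqm⟩, hq⟩, rfl⟩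
    · exact Or.inr ⟨q, ⟨⟨hzq, hqm⟩, hq⟩, rfl⟩

/-- The residual set lies in `[-m, m]` and its members have no prime factor `≤ z` (a prime
dividing `±q` is `q > z`). [cite: Richards1974, §4.2] -/
theorem residualSet_noSmallPrimeFactor {z m : ℕ} :
    ∀ h ∈ ((Finset.Ioc z m).filter Nat.Prime).image (fun q : ℕ => (q : ℤ)) ∪
        ((Finset.Ioc z m).filter Nat.Prime).image (fun q : ℕ => -(q : ℤ)),
      -(m : ℤ) ≤ h ∧ h ≤ m ∧ ∀ q : ℕ, q.Prime → (q : ℤ) ∣ h → z < q := by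
  intro h hh
  obtain ⟨q, hq, hzq, hqm, rfl | rfl⟩ := mem_residualSet_iff.1 hh
  · refine ⟨by omega, by exact_mod_cast hqm, fun q' hq' hdvd => ?_⟩
    have h1 : q' ∣ q := by exact_mod_cast hdvd
    rw [(Nat.prime_dvd_prime_iff_eq hq' hq).1 h1]
    exact hzq
  · refine ⟨by simpa using hqm, by omega, fun q' hq' hdvd => ?_⟩
    have h1 : q' ∣ q := by exact_mod_cast (dvd_neg.1 hdvd)
    rw [(Nat.prime_dvd_prime_iff_eq hq' hq).1 h1]
    exact hzq

/-- The residual set fits in the `x` consecutive integers `(-m - 1, -m - 1 + x]` once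
`2m + 1 ≤ x`. [cite: Richards1974, §4.2] -/
theorem residualSet_subset_Ioc {z m x : ℕ} (hmx : 2 * m + 1 ≤ x) :
    ((Finset.Ioc z m).filter Nat.Prime).image (fun q : ℕ => (q : ℤ)) ∪
        ((Finset.Ioc z m).filter Nat.Prime).image (fun q : ℕ => -(q : ℤ)) ⊆
      Finset.Ioc (-(m : ℤ) - 1) (-(m : ℤ) - 1 + x) := by
  intro h hh
  obtain ⟨hlo, hhi, -⟩ := residualSet_noSmallPrimeFactor h hh
  have hmx' : (2 * m + 1 : ℤ) ≤ x := by exact_mod_cast hmx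
  simp only [Finset.mem_Ioc]
  omega

/-- **The residual set has `2π(m) - 2π(z)` points** ("Number of points left `= 2π(x/2) - 2π(U)`"),
in the subtraction-free form `2π(m) ≤ #R + 2π(z)` (valid also when `m < z`). [cite: Richards1974, §2.4] -/
theorem two_mul_primeCounting_le_card_residualSet (z m : ℕ) :
    2 * π m ≤ #(((Finset.Ioc z m).filter Nat.Prime).image (fun q : ℕ => (q : ℤ)) ∪
        ((Finset.Ioc z m).filter Nat.Prime).image (fun q : ℕ => -(q : ℤ))) + 2 * π z := by
  rcases le_or_gt z m with hzm | hmz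
  · obtain ⟨d, rfl⟩ := Nat.exists_eq_add_of_le hzm
    set T := (Finset.Ioc z (z + d)).filter Nat.Prime with hT
    have hcardT : π (z + d) = π z + #T := primeCounting_add_eq z d
    have hdisj : Disjoint (T.image (fun q : ℕ => (q : ℤ))) (T.image (fun q : ℕ => -(q : ℤ))) := by
      rw [Finset.disjoint_left]
      intro a ha hb
      obtain ⟨q, hq, rfl⟩ := Finset.mem_image.1 ha
      obtain ⟨q', hq', hqq⟩ := Finset.mem_image.1 hb
      have h1 := (Finset.mem_filter.1 hq).2.pos
      have h2 := (Finset.mem_filter.1 hq').2.pos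
      omega
    have hinj : Function.Injective (fun q : ℕ => -(q : ℤ)) := fun a b h => by
      have h' := neg_injective h
      exact_mod_cast h'
    rw [Finset.card_union_of_disjoint hdisj, Finset.card_image_of_injective _ Nat.cast_injective,
      Finset.card_image_of_injective _ hinj, hcardT]
    omega
  · have hmono : π m ≤ π z := Nat.monotone_primeCounting hmz.le
    omega

/-- `π(n + 1) ≤ π(n) + 1`. [folklore] -/
theorem primeCounting_succ_le (n : ℕ) : π (n + 1) ≤ π n + 1 := by
  rw [← Nat.primesLE_card_eq_primeCounting, ← Nat.primesLE_card_eq_primeCounting, Nat.primesLE_succ]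
  split_ifs
  · exact Finset.card_insert_le _ _
  · omega

/-- `log 4 < 3/2` (from `log 2 < 0.6931471808`). [folklore] -/
theorem log_four_lt_three_halves : Real.log 4 < 3 / 2 := by
  have h4 : Real.log 4 = 2 * Real.log 2 := by
    rw [show (4 : ℝ) = 2 ^ 2 by norm_num, Real.log_pow]; ring
  rw [h4]
  have := Real.log_two_lt_d9
  linarith

/-! ### The construction for large `x`: `ρ*(x) ≥ 2π(x/2) - 2π(z) - 2` -/

/-- **Richards' construction, §4.2, for one large `x`.** Let `N ≥ 1` and suppose the
Westzynthius–Erdős–Rankin covering of `{1, …, 4N y}` by one class per prime `q ≤ y` is available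
for all `y ≥ y₀`. If `x ≥ 16`, `log x ≥ 15`, `log x ≥ 3(y₀ + 1)` and `4N log x ≤ √x`, then with
`z = ⌊x/(N log x)⌋` the residual set `{±q : q prime, z < q ≤ ⌊(x-1)/2⌋}` is an admissible tuple
inside `x` consecutive integers with at least `2π(x/2) - 2π(z) - 2` members, so
`2π(x/2) ≤ ρ*(x) + 2π(z) + 2` ((i)–(ii) of §4.2 without the asymptotics: the covering is used
with `y = ⌊log z/log 4⌋`, so that `y# ≤ 4^y ≤ z` and `2⌊(x-1)/2⌋/(z+1) + 1 < N log x + 1 ≤ 4N y`).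
[cite: Richards1974, §4.2–4.5] -/
theorem two_mul_primeCounting_half_le_rhoStar {N y₀ x : ℕ} (hN1 : 1 ≤ N)
    (hcov : ∀ y ≥ y₀, ∃ c : ℕ → ℕ, ∀ i ∈ Finset.Icc 1 (4 * N * y),
      ∃ q : ℕ, q.Prime ∧ q ≤ y ∧ i ≡ c q [MOD q])
    (hx16 : 16 ≤ x) (hL15 : 15 ≤ Real.log x) (hLy : 3 * ((y₀ : ℝ) + 1) ≤ Real.log x)
    (hxa : 4 * N * Real.log x ≤ √(x : ℝ)) :
    2 * π (x / 2) ≤ rhoStar x + 2 * π ⌊(x : ℝ) / (N * Real.log x)⌋₊ + 2 := by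
  have hN : (0 : ℝ) < N := by exact_mod_cast hN1
  have hN1' : (1 : ℝ) ≤ N := by exact_mod_cast hN1
  have hlog4 : 0 < Real.log 4 := Real.log_pos (by norm_num)
  have hlog4' := log_four_lt_three_halves
  set L : ℝ := Real.log x with hL
  have hL0 : 0 < L := by linarith
  have hx16' : (16 : ℝ) ≤ x := by exact_mod_cast hx16
  have hx0 : (0 : ℝ) < x := by linarith
  have hsqrt4 : (4 : ℝ) ≤ √(x : ℝ) := by
    rw [show (4 : ℝ) = √16 by
      rw [show (16 : ℝ) = 4 ^ 2 by norm_num, Real.sqrt_sq (by norm_num)]]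
    exact Real.sqrt_le_sqrt hx16'
  have hNL : (1 : ℝ) ≤ N * L := one_le_mul_of_one_le_of_one_le hN1' (by linarith)
  -- `t = x/(N log x)`, `z = ⌊t⌋`, `m = ⌊(x-1)/2⌋`
  set t : ℝ := (x : ℝ) / (N * L) with ht
  have ht0 : 0 < t := by positivity
  have htsqrt : 4 * √(x : ℝ) ≤ t := by
    rw [ht, le_div_iff₀ (by positivity)]
    calc 4 * √(x : ℝ) * (N * L) = √(x : ℝ) * (4 * N * L) := by ring
      _ ≤ √(x : ℝ) * √(x : ℝ) := by gcongr
      _ = x := Real.mul_self_sqrt hx0.le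
  have hxt : (x : ℝ) / t = N * L := by
    rw [ht]; field_simp
  set z : ℕ := ⌊t⌋₊ with hzdef
  have htz : t < z + 1 := Nat.lt_floor_add_one t
  have hzsqrt : √(x : ℝ) ≤ z := by linarith
  have hz0 : (0 : ℝ) < z := by linarith
  have hlogz : L / 2 ≤ Real.log z := by
    rw [hL, ← Real.log_sqrt hx0.le]
    exact Real.log_le_log (by positivity) hzsqrt
  set m : ℕ := (x - 1) / 2 with hmdef
  have h2m : 2 * m + 1 ≤ x := by omega
  have hxm : x / 2 ≤ m + 1 := by omega
  -- `y = ⌊log z / log 4⌋`, so that `y# ≤ 4^y ≤ z` and `y ≥ log x / 3 - 1 ≥ y₀`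
  set y : ℕ := ⌊Real.log z / Real.log 4⌋₊ with hydef
  have hyle : (y : ℝ) ≤ Real.log z / Real.log 4 := Nat.floor_le (by positivity)
  have hylt : Real.log z / Real.log 4 < y + 1 := Nat.lt_floor_add_one _
  have hyL : L / 3 - 1 ≤ y := by
    have h1 : L / 2 / (3 / 2) ≤ Real.log z / Real.log 4 :=
      (div_le_div_of_nonneg_left (by positivity) hlog4 hlog4'.le).trans
        (div_le_div_of_nonneg_right hlogz hlog4.le)
    have h2 : L / 2 / (3 / 2) = L / 3 := by ring
    linarith
  have h4y : 4 ^ y ≤ z := by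
    have h1 : (y : ℝ) * Real.log 4 ≤ Real.log z := (le_div_iff₀ hlog4).1 hyle
    have h2 : ((4 ^ y : ℕ) : ℝ) ≤ z := by
      have h3 : Real.exp (Real.log 4 * y) ≤ Real.exp (Real.log z) :=
        Real.exp_le_exp.2 (by linarith)
      rw [← Real.rpow_def_of_pos (by norm_num : (0 : ℝ) < 4), Real.rpow_natCast,
        Real.exp_log hz0] at h3
      push_cast
      exact h3
    exact_mod_cast h2
  have hP : primorial y ≤ z + 1 := (primorial_le_four_pow y).trans (h4y.trans (Nat.le_succ z))
  have hyz : y ≤ z := (Nat.lt_pow_self (by norm_num)).le.trans h4y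
  have hy₀y : y₀ ≤ y := by
    have : (y₀ : ℝ) ≤ y := by linarith
    exact_mod_cast this
  obtain ⟨c, hc⟩ := hcov y hy₀y
  -- a class mod `p > z` has at most `2m/(z+1) + 1 < N log x + 1 ≤ 4 N y` members in `[-m, m]`
  have hK : 2 * m / (z + 1) + 1 ≤ 4 * N * y := by
    have h1 : 2 * m / (z + 1) ≤ x / (z + 1) := Nat.div_le_div_right (by omega)
    have h2 : ((x / (z + 1) : ℕ) : ℝ) ≤ (x : ℝ) / ((z : ℝ) + 1) := by
      have := Nat.cast_div_le (m := x) (n := z + 1) (α := ℝ)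
      push_cast at this
      exact this
    have h3 : (x : ℝ) / ((z : ℝ) + 1) < N * L := by
      rw [← hxt]
      exact div_lt_div_of_pos_left hx0 ht0 htz
    have h4a : 4 * (N : ℝ) * (L / 3 - 1) ≤ 4 * N * y := mul_le_mul_of_nonneg_left hyL (by positivity)
    have h4b : (N : ℝ) * 15 ≤ N * L := mul_le_mul_of_nonneg_left hL15 hN.le
    have h4 : (N : ℝ) * L + 1 ≤ 4 * N * y := by linarith
    have h5 : ((2 * m / (z + 1) + 1 : ℕ) : ℝ) < ((4 * N * y : ℕ) : ℝ) := by
      have h1' : ((2 * m / (z + 1) : ℕ) : ℝ) ≤ ((x / (z + 1) : ℕ) : ℝ) := by exact_mod_cast h1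
      push_cast
      linarith
    exact (Nat.cast_lt.1 h5).le
  -- the residual set `R = {±q : q prime, z < q ≤ m}` is admissible and lies in `(-m-1, -m-1+x]`
  set R : Finset ℤ := ((Finset.Ioc z m).filter Nat.Prime).image (fun q : ℕ => (q : ℤ)) ∪
    ((Finset.Ioc z m).filter Nat.Prime).image (fun q : ℕ => -(q : ℤ)) with hR
  have hadm : Literature.NumberTheory.Sieve.IsAdmissibleTuple R :=
    isAdmissibleTuple_of_noSmallPrimeFactor residualSet_noSmallPrimeFactor hc hyz hP hK
  have hrho : #R ≤ rhoStar x :=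
    le_rhoStar_of_subset_Ioc (a := -(m : ℤ) - 1) hadm (residualSet_subset_Ioc h2m)
  have hcard : 2 * π m ≤ #R + 2 * π z := two_mul_primeCounting_le_card_residualSet z m
  have hπm : π (x / 2) ≤ π m + 1 :=
    (Nat.monotone_primeCounting hxm).trans (primeCounting_succ_le m)
  omega

/-- **The loss of the midpoint sieve (Richards §2.5), bounded by Chebyshev:** for `N ≥ 1`,
`x ≥ 16`, `log x ≥ 15` and `4N log x ≤ √x`, with `z = ⌊x/(N log x)⌋` one has
`π(z) ≤ (4 log 4/N) · x/(log x)² + √x` (Mathlib's `π(t) ≤ (log 4) t/log √t + √t` at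
`t = x/(N log x) ≥ 4√x`, where `log √t ≥ (log x)/4`). Richards: "our loss would be
`(2/N)[x/(log x)²]`" by the prime number theorem; Chebyshev's constant suffices here.
[cite: Richards1974, §2.5] -/
theorem primeCounting_sieveLimit_le {N x : ℕ} (hN1 : 1 ≤ N) (hx16 : 16 ≤ x)
    (hL15 : 15 ≤ Real.log x) (hxa : 4 * N * Real.log x ≤ √(x : ℝ)) :
    (π ⌊(x : ℝ) / (N * Real.log x)⌋₊ : ℝ) ≤
      4 * Real.log 4 / N * ((x : ℝ) / Real.log x ^ 2) + √(x : ℝ) := by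
  have hN : (0 : ℝ) < N := by exact_mod_cast hN1
  have hN1' : (1 : ℝ) ≤ N := by exact_mod_cast hN1
  set L : ℝ := Real.log x with hL
  have hL0 : 0 < L := by linarith
  have hx16' : (16 : ℝ) ≤ x := by exact_mod_cast hx16
  have hx0 : (0 : ℝ) < x := by linarith
  have hsqrt4 : (4 : ℝ) ≤ √(x : ℝ) := by
    rw [show (4 : ℝ) = √16 by
      rw [show (16 : ℝ) = 4 ^ 2 by norm_num, Real.sqrt_sq (by norm_num)]]
    exact Real.sqrt_le_sqrt hx16'
  have hNL : (1 : ℝ) ≤ N * L := one_le_mul_of_one_le_of_one_le hN1' (by linarith)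
  set t : ℝ := (x : ℝ) / (N * L) with ht
  have ht0 : 0 < t := by positivity
  have htx : t ≤ x := div_le_self hx0.le hNL
  have htsqrt : 4 * √(x : ℝ) ≤ t := by
    rw [ht, le_div_iff₀ (by positivity)]
    calc 4 * √(x : ℝ) * (N * L) = √(x : ℝ) * (4 * N * L) := by ring
      _ ≤ √(x : ℝ) * √(x : ℝ) := by gcongr
      _ = x := Real.mul_self_sqrt hx0.le
  have ht1 : 1 < t := by linarith
  have hcheb : (π ⌊t⌋₊ : ℝ) ≤ Real.log 4 * t / Real.log (√t) + √t :=
    Chebyshev.pi_le_log4_mul_div ht1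
  have hlogt : L / 2 ≤ Real.log t := by
    rw [hL, ← Real.log_sqrt hx0.le]
    exact Real.log_le_log (by positivity) (by linarith)
  have hlogt0 : 0 < Real.log t := by linarith
  have h1 : Real.log 4 * t / Real.log (√t) = 2 * Real.log 4 * t / Real.log t := by
    rw [Real.log_sqrt ht0.le]; field_simp
  have h2 : 2 * Real.log 4 * t / Real.log t ≤ 2 * Real.log 4 * t / (L / 2) :=
    div_le_div_of_nonneg_left (by positivity) (by positivity) hlogt
  have h3 : 2 * Real.log 4 * t / (L / 2) = 4 * Real.log 4 / N * ((x : ℝ) / L ^ 2) := by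
    rw [ht]; field_simp; ring
  have h5 : √t ≤ √(x : ℝ) := Real.sqrt_le_sqrt htx
  linarith

/-! ### Theorem 4.1 -/

/-- **Hensley–Richards' theorem (Richards 1974, Theorem 4.1), PROVED**: for every `ε > 0` and all
sufficiently large `x`, `ρ*(x) - π(x) > (log 2 - ε) x/(log x)²`; in particular `ρ*(x) - π(x) → +∞`.
Discharges the named fact `HensleyRichards1974` by Richards' §4.2 construction
(`two_mul_primeCounting_half_le_rhoStar`: `ρ*(x) ≥ 2π(x/2) - 2π(z) - 2` with `z = ⌊x/(N log x)⌋`,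
from the Westzynthius–Erdős–Rankin covering `Literature.NumberTheory.Sieve.exists_residueClasses_cover`
and the Chinese remainder theorem), the GAIN `2π(x/2) - π(x) ≥ (log 2 - ε/3) x/(log x)²` from the
prime number theorem with de la Vallée Poussin's error term
(`Literature.NumberTheory.LFunctions.eventually_richards_gain_nat`) and the LOSS
`2π(z) + 2 ≤ (8 log 4/N) x/(log x)² + 2√x + 2 < (2ε/3) x/(log x)²` for `N > 36/ε`
(`primeCounting_sieveLimit_le`, Chebyshev). [cite: Richards1974, Theorem 4.1 (p. 430) and §4.2–4.5] [cite: HensleyRichards1974, §2] -/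
theorem HensleyRichards1974_holds : HensleyRichards1974 := by
  intro ε hε
  -- the constant `N > 36/ε`
  obtain ⟨N, hNε, hN1⟩ : ∃ N : ℕ, 36 / ε < N ∧ 1 ≤ N :=
    ⟨⌈36 / ε⌉₊ + 1, by push_cast; linarith [Nat.le_ceil (36 / ε)], by omega⟩
  have hN : (0 : ℝ) < N := by exact_mod_cast hN1
  -- the Westzynthius–Erdős–Rankin covering with parameter `4N`, available for `y ≥ y₀`
  obtain ⟨y₀, hy₀⟩ := eventually_atTop.1
    (Literature.NumberTheory.Sieve.exists_residueClasses_cover (4 * N))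
  -- Richards' gain with `ε/3`
  have hgain := Literature.NumberTheory.LFunctions.eventually_richards_gain_nat (ε := ε / 3)
    (by positivity)
  -- (a) `4 N log x ≤ √x` for large real `x`
  have ha : ∀ᶠ x : ℝ in atTop, 4 * N * Real.log x ≤ √x := by
    have h := (isLittleO_log_rpow_atTop (by norm_num : (0 : ℝ) < 1 / 2)).bound
      (show (0 : ℝ) < 1 / (4 * N) by positivity)
    filter_upwards [h, eventually_ge_atTop 1] with x hx hx1
    rw [Real.norm_of_nonneg (Real.log_nonneg hx1), Real.norm_of_nonneg (by positivity),
      ← Real.sqrt_eq_rpow] at hx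
    calc 4 * N * Real.log x ≤ 4 * N * (1 / (4 * N) * √x) := by gcongr
      _ = √x := by field_simp
  -- (b) `√x + 1 < (ε/6) x/(log x)²` for large real `x`
  have hb : ∀ᶠ x : ℝ in atTop, √x + 1 < ε / 6 * (x / Real.log x ^ 2) := by
    have h1 := (isLittleO_log_rpow_rpow_atTop 2 (by norm_num : (0 : ℝ) < 1 / 2)).bound
      (show (0 : ℝ) < ε / 24 by positivity)
    have h2 := Literature.NumberTheory.LFunctions.tendsto_self_div_log_sq_atTop.eventually_ge_atTop
      (24 / ε)
    filter_upwards [h1, h2, eventually_gt_atTop 1] with x hx hx2 hx1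
    have hlog : 0 < Real.log x := Real.log_pos hx1
    have hx0 : 0 < x := by linarith
    rw [Real.norm_of_nonneg (by positivity), Real.norm_of_nonneg (by positivity),
      ← Real.sqrt_eq_rpow, Real.rpow_two] at hx
    have hX : 0 < x / Real.log x ^ 2 := by positivity
    have h3 : √x ≤ ε / 24 * (x / Real.log x ^ 2) := by
      rw [mul_div_assoc', le_div_iff₀ (pow_pos hlog 2)]
      calc √x * Real.log x ^ 2 ≤ √x * (ε / 24 * √x) := by gcongr
        _ = ε / 24 * x := by rw [mul_left_comm, Real.mul_self_sqrt hx0.le]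
    have h4 : 1 ≤ ε / 24 * (x / Real.log x ^ 2) := by
      have := mul_le_mul_of_nonneg_left hx2 (show (0 : ℝ) ≤ ε / 24 by positivity)
      rwa [show ε / 24 * (24 / ε) = 1 by field_simp] at this
    linarith
  -- (c) `log x ≥ max 15 (3 (y₀ + 1))` for large real `x`
  have hc : ∀ᶠ x : ℝ in atTop, max 15 (3 * ((y₀ : ℝ) + 1)) ≤ Real.log x :=
    Real.tendsto_log_atTop.eventually_ge_atTop _
  filter_upwards [hgain, tendsto_natCast_atTop_atTop.eventually ha,
    tendsto_natCast_atTop_atTop.eventually hb, tendsto_natCast_atTop_atTop.eventually hc,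
    eventually_ge_atTop 16] with x hg hxa hxb hxc hx16
  obtain ⟨hL15, hLy⟩ := max_le_iff.1 hxc
  have h1 : (2 * π (x / 2) : ℝ) ≤ rhoStar x + 2 * π ⌊(x : ℝ) / (N * Real.log x)⌋₊ + 2 := by
    exact_mod_cast two_mul_primeCounting_half_le_rhoStar hN1 hy₀ hx16 hL15 hLy hxa
  have h2 := primeCounting_sieveLimit_le hN1 hx16 hL15 hxa
  -- `4 log 4/N ≤ ε/6` since `N ε > 36 > 24 log 4`
  have h3 : 4 * Real.log 4 / N * ((x : ℝ) / Real.log x ^ 2) ≤ ε / 6 * ((x : ℝ) / Real.log x ^ 2) := by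
    refine mul_le_mul_of_nonneg_right ?_ (by positivity)
    rw [div_le_iff₀ hN, show ε / 6 * (N : ℝ) = N * ε / 6 by ring]
    have h36 : (36 : ℝ) < N * ε := (div_lt_iff₀ hε).1 hNε
    have hlog4' := log_four_lt_three_halves
    linarith
  have hX : 0 < (x : ℝ) / Real.log x ^ 2 := by
    have hx0 : (0 : ℝ) < x := by exact_mod_cast (show 0 < x by omega)
    positivity
  linarith

end Literature.Barriers.Parity
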